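import Summits.QuantumAdvantage.QuantumAdvantage.Statement
import Literature.Computability.Complexity.AlmostPProofs
import Literature.Computability.Complexity.BPPSubsetAlmostP
import Literature.Computability.Complexity.CoinCounting
import Literature.Computability.Cryptography.ClassBQP
import Mathlib.Topology.GDelta.Basic
import Mathlib.Topology.Baire.Lemmas
import Mathlib.Topology.Baire.LocallyCompactRegular
import HarnessLib

/-!
# The Baire-category (generic-oracle) rung of `QuantumAdvantage`

`QuantumAdvantage` is `∃ L, L ∈ BQP ∧ L ∉ BPP`. Oracles `A ⊆ {0,1}*` are identified with points
`f` of the Cantor space `{0,1}^{{0,1}*}` (`List Bool → Bool`, product of discrete topologies;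
`A = {w | f w = true}`), a compact Hausdorff — hence Baire — space. This file records, sorry-free
and over the tree's transcript model of oracle machines (`OracleAlg`, `runWith`, `PRel`,
`BPPRel O = bp (PRel O)`, `BQPRel`):

* `soloBlind_isOpen_setOf_determined` / `soloBlind_isClosed_setOf_determined` — an event of
  oracles that is *determined* by finitely many oracle bits (`IsDetermined`, the tree's notion
  from the random-oracle development) is clopen;
* `soloBlind_isClosed_setOf_goodSet` — for a fixed machine and budget, "`M^A` outputs `[x ∈ L]`
  on every input" is a closed event (a countable intersection of determined run events);
* `soloBlind_PRel_subset_P_of_forall_length_lt` — a finite oracle gives no power, `P^{A₀} ⊆ P`;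
* `soloBlind_isMeagre_setOf_mem_PRel` — **if `L ∉ P` then `{A | L ∈ P^A}` is meagre**: it is a
  countable union (over machines and polynomial budgets) of closed events, and a closed event with
  an interior point contains a basic box of oracles agreeing with a point `f` on a finite set `I`
  of strings; the *finite* oracle `I ∩ f⁻¹(1)` lies in the box, so `L ∈ P^{A₀}` for a finite
  `A₀`, whence `L ∈ P` (`P^{P^O} = P^O`, `P^O` is closed under finite variation, `P^∅ = P` — all
  discharged tree theorems);
* `soloBlind_isMeagre_setOf_mem_BPPRel` — **if `L ∉ BPP` then `{A | L ∈ BPP^A}` is meagre**: the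
  same argument one level up, the closed events now being "the capped machine halts on every
  input relative to `A`, and its language gives the right `2/3`-vote on every `x`" (the vote on
  `x` is determined by the finitely many oracle bits queried over all coin strings of length
  `p |x|`), and a finite oracle giving `L ∈ BPP^{A₀} ⊆ bp P = BPP`;
* `soloBlind_isMeagre_setOf_BQPRel_subset_PRel` — if `BQP ⊄ P` then `BQP^A ⊆ P^A` fails for all
  oracles `A` outside a meagre set (one oracle-free witness serves every `A`);
* `soloBlind_category_rung_BPPRel`, `soloBlind_category_witness_BPPRel`,
  `soloBlind_category_rung_BPPRel_dense` — **the summit implies that for comeager-many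
  ("generic") oracles `A`, `BQP^A ⊄ BPP^A`**, with one oracle-free witness `L ∈ BQP ∖ BPP` lying
  in every `BQP^A` and in `BPP^A` only for a meagre set of `A`; in particular such oracles are
  dense;
* `soloBlind_category_rung`, `soloBlind_category_witness`, `soloBlind_category_rung_dense` — the
  `P^A` form of the same, which already follows from `BQP ⊄ P` (i.e. from
  `QuantumAdvantage ∨ P ≠ BPP`).

Reading. This is the category twin of the measure-one rung (`SoloBlindMeasureOne`): there the
summit gives `¬ ∀ᵐ A, BQP^A ⊆ P^A` through Bennett–Gill `ALMOST-P = BPP`; here it gives the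
comeager statements through the much softer fact that a non-meagre `F_σ` event of oracles
contains a finite-table box, together with `P^{finite} = P`. As with every consequence of the
summit recorded in this series, the rung is not a route: by Fortnow–Rogers 1999, Thm. 3.6 (from
Fenner–Fortnow–Kurtz–Li and Nisan–Szegedy), unrelativized `P = PSPACE` would give
`P^G = BQP^G` for every generic `G`, so the comeager statement itself implies `P ≠ PSPACE`,
exactly like the summit (which implies `PP ⊄ BPP`). What the kernel certifies is the precise
logical position of the generic-oracle analogue: implied by the summit, by one oracle-free
witness, uniformly in the oracle — in contrast with the single-oracle analogue, which is a
theorem (Bernstein–Vazirani, Simon) and decides nothing about the summit.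

References: L. Fortnow, J. Rogers, *Complexity limitations on quantum computation*,
J. Comput. System Sci. 59 (1999) 240–252 (arXiv:cs/9811023), Thm. 3.6, Cor. 3.7, Thm. 4.2, §5;
S. Fenner, L. Fortnow, S. Kurtz, L. Li, *An oracle builder's toolkit*, Inform. and Comput. 182
(2003) 95–136 (generic oracles); M. Blum, R. Impagliazzo, *Generic oracles and oracle classes*,
FOCS 1987; C. H. Bennett, J. Gill, SIAM J. Comput. 10 (1981) 96–113, §1 (finite-table cylinders,
finite variation); J. C. Oxtoby, *Measure and Category*, 2nd ed., Springer GTM 2 (1980), Ch. 9.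
-/

namespace Summit.QuantumAdvantage.QuantumAdvantage.Theorems

open Topology Filter _root_.Computability Literature.Computability.Complexity
  Literature.Computability.Complexity.Classes Literature.Computability.Complexity.OracleAlg
  Literature.Computability.Cryptography Literature.Computability.QuantumComplexity

/-- A finitely determined event of oracles is open in the Cantor topology: around each of its
points it contains the box of oracles with the same bits on the determining set `U`. -/
theorem soloBlind_isOpen_setOf_determined {U : Finset (List Bool)} {E : Set (Set (List Bool))}
    (hE : IsDetermined U E) :
    IsOpen {f : List Bool → Bool | ({w | f w = true} : Set (List Bool)) ∈ E} := by
  refine isOpen_iff_forall_mem_open.2 fun f hf => ?_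
  refine ⟨{g : List Bool → Bool | ∀ u ∈ U, g u = f u}, fun g hg => ?_, ?_, fun u _ => rfl⟩
  · show ({w | g w = true} : Set (List Bool)) ∈ E
    refine (hE (A := {w | g w = true}) (A' := {w | f w = true}) ?_).2 hf
    funext u
    rw [Bool.eq_iff_iff, restrictBool_eq_true_iff, restrictBool_eq_true_iff]
    show g u = true ↔ f u = true
    rw [hg u.1 u.2]
  · have hset : {g : List Bool → Bool | ∀ u ∈ U, g u = f u} = ⋂ u ∈ U, (fun g => g u) ⁻¹' {f u} := by
      ext g; simp
    rw [hset]
    exact isOpen_biInter_finset fun u _ => (isOpen_discrete {f u}).preimage (continuous_apply u)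

/-- A finitely determined event of oracles is closed (its complement is determined too). -/
theorem soloBlind_isClosed_setOf_determined {U : Finset (List Bool)} {E : Set (Set (List Bool))}
    (hE : IsDetermined U E) :
    IsClosed {f : List Bool → Bool | ({w | f w = true} : Set (List Bool)) ∈ E} := by
  have h := (soloBlind_isOpen_setOf_determined hE.compl).isClosed_compl
  convert h using 1
  ext f
  simp

/-- For a fixed oracle machine `M` and budget `q`, the oracles `A` for which `M^A` outputs
`[x ∈ L]` on every input `x` (the tree's `goodSet`) form a closed event: a countable intersection
of determined run events. -/
theorem soloBlind_isClosed_setOf_goodSet (L : Language Bool) (M : OracleAlg Bool) (q : Polynomial ℕ) :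
    IsClosed {f : List Bool → Bool | ({w | f w = true} : Set (List Bool)) ∈ goodSet L M q} := by
  have hset : {f : List Bool → Bool | ({w | f w = true} : Set (List Bool)) ∈ goodSet L M q} =
      ⋂ x : List Bool, {f : List Bool → Bool | ({w | f w = true} : Set (List Bool)) ∈
        {A : Set (List Bool) | runWith M x (fun _ u => A.boolIndicator u) (q.eval x.length) [] =
          some (L.boolIndicator x)}} := by
    ext f
    simp only [goodSet, Set.mem_setOf_eq, Set.mem_iInter]
  rw [hset]
  exact isClosed_iInter fun x =>
    soloBlind_isClosed_setOf_determined (isDetermined_runEvent M x (q.eval x.length) ∅ (L.boolIndicator x))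

/-- **A finite oracle gives no power**: `P^{A₀} ⊆ P` for a finite set `A₀` of strings (here: a
set of strings all shorter than some bound), from the tree's `P^{P^O} ⊆ P^O`, finite-variation
closure of `P^O`, `A ∈ P^A` and `P^∅ = P`. -/
theorem soloBlind_PRel_subset_P_of_forall_length_lt {A₀ : Set (List Bool)} (n₀ : ℕ)
    (h : ∀ x ∈ A₀, x.length < n₀) : PRel (Oracle.ofLanguage A₀) ⊆ Classes.P := by
  have hA0 : A₀ ∈ PRel Oracle.empty := by
    refine mem_PRel_of_eqOn_le (self_mem_PRel_ofLanguage_holds (0 : Language Bool)) n₀ fun x hx => ?_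
    have hx' : x ∉ A₀ := fun hx' => absurd (h x hx') (not_lt.2 hx)
    exact ⟨fun hx'' => (hx' hx'').elim, fun h0 => (Language.notMem_zero x h0).elim⟩
  have h4 : PRel Oracle.empty = Classes.P := PRel_empty_holds
  rw [← h4]
  exact PRel_subset_PRel_of_mem_FPRel (ofLanguage_mem_FPRel_of_mem_PRel hA0)

/-- **If `L ∉ P` then `{A | L ∈ P^A}` is meagre** in the Cantor space of oracles. The event is a
countable union, over polynomial-time machines `M` and budgets `q`, of the closed events
"`(M.capQ q)^A` decides `L`"; if one of them had an interior point `f`, it would contain the box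
of oracles agreeing with `f` on a finite set `I` of strings, in particular the finite oracle
`I ∩ f⁻¹(1)`, and then `L ∈ P^{finite} = P`. -/
theorem soloBlind_isMeagre_setOf_mem_PRel {L : Language Bool} (hL : L ∉ Classes.P) :
    IsMeagre {f : List Bool → Bool | L ∈ PRel (Oracle.ofLanguage {w | f w = true})} := by
  haveI : Countable (Polynomial ℕ) := countable_polynomial_nat
  haveI : Countable {M : OracleAlg Bool // M.IsPolyTime encodingBoolBool} :=
    (countable_setOf_isPolyTime encodingBoolBool).to_subtype
  have hcover : {f : List Bool → Bool | L ∈ PRel (Oracle.ofLanguage {w | f w = true})} ⊆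
      ⋃ i : {M : OracleAlg Bool // M.IsPolyTime encodingBoolBool} × Polynomial ℕ,
        {f : List Bool → Bool | ({w | f w = true} : Set (List Bool)) ∈
          goodSet L (i.1.1.capQ i.2 false) i.2} := by
    intro f hf
    obtain ⟨i, hi⟩ := Set.mem_iUnion.1 (setOf_mem_PRel_subset_iUnion L hf)
    exact Set.mem_iUnion.2 ⟨i, decidesRel_subset_goodSet L _ _ hi⟩
  refine IsMeagre.mono hcover (isMeagre_iUnion fun i => ?_)
  obtain ⟨⟨M, hM⟩, q⟩ := i
  refine ((soloBlind_isClosed_setOf_goodSet L (M.capQ q false) q).isNowhereDense_iff.2 ?_).isMeagre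
  rw [Set.eq_empty_iff_forall_notMem]
  intro f hf
  obtain ⟨I, u, hu, hsub⟩ := isOpen_pi_iff.1 isOpen_interior f hf
  -- the finite oracle `I ∩ f⁻¹(1)` lies in the box around `f`
  have hgI : (fun w => decide (w ∈ I) && f w) ∈ (I : Set (List Bool)).pi u := by
    refine Set.mem_pi.2 fun w hw => ?_
    have hw' : w ∈ I := Finset.mem_coe.1 hw
    show (decide (w ∈ I) && f w) ∈ u w
    rw [decide_eq_true hw', Bool.true_and]
    exact (hu w hw').2
  have hgood' : (fun w => decide (w ∈ I) && f w) ∈ {f : List Bool → Bool |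
      ({w | f w = true} : Set (List Bool)) ∈ goodSet L (M.capQ q false) q} :=
    interior_subset (hsub hgI)
  have hgood : ({w | (decide (w ∈ I) && f w) = true} : Set (List Bool)) ∈ goodSet L (M.capQ q false) q :=
    hgood'
  have hPA : L ∈ PRel (Oracle.ofLanguage {w | (decide (w ∈ I) && f w) = true}) := by
    refine mem_PRel_iff.2 ⟨M.capQ q false, OracleAlg.isPolyTime_capQ encodingBoolBool hM q false, q, fun x => ⟨?_, ?_⟩⟩
    · rw [run_ofLanguage_eq_runWith]
      exact hgood x
    · exact fun y hy => length_le_of_mem_queries_capQ M q false _ x _ hy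
  refine hL (soloBlind_PRel_subset_P_of_forall_length_lt (I.sup List.length + 1) (fun x hx => ?_) hPA)
  have hxI : x ∈ I := by
    have hx' : (decide (x ∈ I) && f x) = true := hx
    rw [Bool.and_eq_true, decide_eq_true_eq] at hx'
    exact hx'.1
  exact Nat.lt_succ_of_le (Finset.le_sup (f := List.length) hxI)

/-- From a capped polynomial-time oracle machine `M' = M.capQ q false` that halts within budget
on every input relative to `A₀`, and whose language relative to `A₀` gives the right `2/3`-vote
on `L` with `p |x|` coins, read off `L ∈ BPP^{A₀} = bp (P^{A₀})`. -/
theorem soloBlind_mem_BPPRel_of_total_vote {L : Language Bool} {A₀ : Set (List Bool)}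
    {M : OracleAlg Bool} (hM : M.IsPolyTime encodingBoolBool) (q p : Polynomial ℕ)
    (htot : ∀ z : List Bool, ∃ b : Bool,
      runWith (M.capQ q false) z (fun _ u => A₀.boolIndicator u) (q.eval z.length) [] = some b)
    (hvote : ∀ x : List Bool, 2 / 3 ≤ uniformProb (p.eval x.length) {y : List Bool |
      runWith (M.capQ q false) (boolPair x y) (fun _ u => A₀.boolIndicator u)
        (q.eval (boolPair x y).length) [] = some true ↔ x ∈ L}) :
    L ∈ BPPRel (Oracle.ofLanguage A₀) := by
  have hL'P : {z : List Bool | runWith (M.capQ q false) z (fun _ u => A₀.boolIndicator u)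
      (q.eval z.length) [] = some true} ∈ PRel (Oracle.ofLanguage A₀) := by
    refine mem_PRel_iff.2 ⟨M.capQ q false, OracleAlg.isPolyTime_capQ encodingBoolBool hM q false, q,
      fun z => ⟨?_, ?_⟩⟩
    · rw [run_ofLanguage_eq_runWith]
      obtain ⟨b, hb⟩ := htot z
      rw [hb]
      cases b with
      | true =>
        rw [(Set.mem_iff_boolIndicator _ _).1 (show z ∈ {z : List Bool | runWith (M.capQ q false) z
          (fun _ u => A₀.boolIndicator u) (q.eval z.length) [] = some true} from hb)]
      | false =>
        have hz : z ∉ {z : List Bool | runWith (M.capQ q false) z (fun _ u => A₀.boolIndicator u)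
            (q.eval z.length) [] = some true} := fun hz =>
          Bool.false_ne_true (Option.some_inj.1 (hb.symm.trans hz))
        rw [(Set.notMem_iff_boolIndicator _ _).1 hz]
    · exact fun y hy => length_le_of_mem_queries_capQ M q false _ z _ hy
  exact ⟨_, hL'P, p, fun x => hvote x⟩

/-- **If `L ∉ BPP` then `{A | L ∈ BPP^A}` is meagre** in the Cantor space of oracles.
`L ∈ BPP^A = bp (P^A)` is witnessed by a polynomial-time oracle machine `M` with capped budget `q`
that halts on every input relative to `A` and whose language gives the right `2/3`-vote with
`p |x|` coins; for fixed `(M, q, p)` both clauses are closed events (halting on `z`, and the vote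
on `x`, are each determined by finitely many oracle bits), so the event is a countable union of
closed sets; an interior point yields, as in `soloBlind_isMeagre_setOf_mem_PRel`, a *finite*
oracle `A₀` with `L ∈ BPP^{A₀} ⊆ bp (P) = BPP`. -/
theorem soloBlind_isMeagre_setOf_mem_BPPRel {L : Language Bool} (hL : L ∉ BPP) :
    IsMeagre {f : List Bool → Bool | L ∈ BPPRel (Oracle.ofLanguage {w | f w = true})} := by
  haveI : Countable (Polynomial ℕ) := countable_polynomial_nat
  haveI : Countable {M : OracleAlg Bool // M.IsPolyTime encodingBoolBool} :=
    (countable_setOf_isPolyTime encodingBoolBool).to_subtype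
  have hcover : {f : List Bool → Bool | L ∈ BPPRel (Oracle.ofLanguage {w | f w = true})} ⊆
      ⋃ i : ({M : OracleAlg Bool // M.IsPolyTime encodingBoolBool} × Polynomial ℕ) × Polynomial ℕ,
        {f : List Bool → Bool |
          (∀ z : List Bool, ∃ b : Bool, runWith (i.1.1.1.capQ i.1.2 false) z
              (fun _ u => ({w | f w = true} : Set (List Bool)).boolIndicator u)
              (i.1.2.eval z.length) [] = some b) ∧
          ∀ x : List Bool, 2 / 3 ≤ uniformProb (i.2.eval x.length) {y : List Bool |
            runWith (i.1.1.1.capQ i.1.2 false) (boolPair x y)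
              (fun _ u => ({w | f w = true} : Set (List Bool)).boolIndicator u)
              (i.1.2.eval (boolPair x y).length) [] = some true ↔ x ∈ L}} := by
    intro f hf
    obtain ⟨L', hL'A, p, hp⟩ := (hf : L ∈ bp (PRel (Oracle.ofLanguage {w | f w = true})))
    obtain ⟨M, hM, q, hMq⟩ := mem_PRel_iff.1 hL'A
    have hG := decidesRel_subset_goodSet L' M q (show DecidesRel L' M q {w | f w = true} from hMq)
    refine Set.mem_iUnion.2 ⟨((⟨M, hM⟩, q), p), fun z => ⟨L'.boolIndicator z, hG z⟩, fun x => ?_⟩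
    have hset : {y : List Bool | runWith (M.capQ q false) (boolPair x y)
        (fun _ u => ({w | f w = true} : Set (List Bool)).boolIndicator u)
        (q.eval (boolPair x y).length) [] = some true ↔ x ∈ L} =
        {y : List Bool | boolPair x y ∈ L' ↔ x ∈ L} := by
      ext y
      rw [Set.mem_setOf_eq, Set.mem_setOf_eq, hG (boolPair x y), Option.some_inj]
      exact iff_congr (Set.mem_iff_boolIndicator _ _).symm Iff.rfl
    show 2 / 3 ≤ uniformProb (p.eval x.length) _
    rw [hset]
    exact hp x
  refine IsMeagre.mono hcover (isMeagre_iUnion fun i => ?_)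
  obtain ⟨⟨⟨M, hM⟩, q⟩, p⟩ := i
  have hclosed : IsClosed {f : List Bool → Bool |
      (∀ z : List Bool, ∃ b : Bool, runWith (M.capQ q false) z
          (fun _ u => ({w | f w = true} : Set (List Bool)).boolIndicator u) (q.eval z.length) [] = some b) ∧
      ∀ x : List Bool, 2 / 3 ≤ uniformProb (p.eval x.length) {y : List Bool |
        runWith (M.capQ q false) (boolPair x y)
          (fun _ u => ({w | f w = true} : Set (List Bool)).boolIndicator u)
          (q.eval (boolPair x y).length) [] = some true ↔ x ∈ L}} := by
    rw [Set.setOf_and]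
    refine IsClosed.inter ?_ ?_
    · rw [Set.setOf_forall]
      refine isClosed_iInter fun z => ?_
      rw [Set.setOf_exists]
      exact isClosed_iUnion_of_finite fun b =>
        soloBlind_isClosed_setOf_determined (isDetermined_runEvent (M.capQ q false) z (q.eval z.length) ∅ b)
    · rw [Set.setOf_forall]
      refine isClosed_iInter fun x => ?_
      classical
      refine soloBlind_isClosed_setOf_determined
        (U := (Finset.univ : Finset (List.Vector Bool (p.eval x.length))).biUnion fun v =>
          queryBound (M.capQ q false) (boolPair x v.toList) (q.eval (boolPair x v.toList).length) ∅)
        (E := {A : Set (List Bool) | 2 / 3 ≤ uniformProb (p.eval x.length) {y : List Bool |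
          runWith (M.capQ q false) (boolPair x y) (fun _ u => A.boolIndicator u)
            (q.eval (boolPair x y).length) [] = some true ↔ x ∈ L}}) ?_
      intro A A' h
      simp only [Set.mem_setOf_eq]
      rw [uniformProb_eq_cnt_div, uniformProb_eq_cnt_div, cnt_congr fun y hy => ?_]
      obtain ⟨v, rfl⟩ : ∃ v : List.Vector Bool (p.eval x.length), v.toList = y := ⟨⟨y, hy⟩, rfl⟩
      have hdet := (isDetermined_runEvent (M.capQ q false) (boolPair x v.toList)
        (q.eval (boolPair x v.toList).length) ∅ true).mono
        (Finset.subset_biUnion_of_mem (fun v : List.Vector Bool (p.eval x.length) =>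
          queryBound (M.capQ q false) (boolPair x v.toList) (q.eval (boolPair x v.toList).length) ∅)
          (Finset.mem_univ v)) h
      exact iff_congr hdet Iff.rfl
  refine (hclosed.isNowhereDense_iff.2 ?_).isMeagre
  rw [Set.eq_empty_iff_forall_notMem]
  intro f hf
  obtain ⟨I, u, hu, hsub⟩ := isOpen_pi_iff.1 isOpen_interior f hf
  have hgI : (fun w => decide (w ∈ I) && f w) ∈ (I : Set (List Bool)).pi u := by
    refine Set.mem_pi.2 fun w hw => ?_
    have hw' : w ∈ I := Finset.mem_coe.1 hw
    show (decide (w ∈ I) && f w) ∈ u w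
    rw [decide_eq_true hw', Bool.true_and]
    exact (hu w hw').2
  have hmem' : (fun w => decide (w ∈ I) && f w) ∈ {f : List Bool → Bool |
      (∀ z : List Bool, ∃ b : Bool, runWith (M.capQ q false) z
          (fun _ u => ({w | f w = true} : Set (List Bool)).boolIndicator u) (q.eval z.length) [] = some b) ∧
      ∀ x : List Bool, 2 / 3 ≤ uniformProb (p.eval x.length) {y : List Bool |
        runWith (M.capQ q false) (boolPair x y)
          (fun _ u => ({w | f w = true} : Set (List Bool)).boolIndicator u)
          (q.eval (boolPair x y).length) [] = some true ↔ x ∈ L}} :=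
    interior_subset (hsub hgI)
  have hmem : (∀ z : List Bool, ∃ b : Bool, runWith (M.capQ q false) z
      (fun _ u => ({w | (decide (w ∈ I) && f w) = true} : Set (List Bool)).boolIndicator u)
      (q.eval z.length) [] = some b) ∧
      ∀ x : List Bool, 2 / 3 ≤ uniformProb (p.eval x.length) {y : List Bool |
        runWith (M.capQ q false) (boolPair x y)
          (fun _ u => ({w | (decide (w ∈ I) && f w) = true} : Set (List Bool)).boolIndicator u)
          (q.eval (boolPair x y).length) [] = some true ↔ x ∈ L} :=
    hmem'
  have hLA₀ := soloBlind_mem_BPPRel_of_total_vote hM q p hmem.1 hmem.2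
  have hfin : ∀ x ∈ ({w | (decide (w ∈ I) && f w) = true} : Set (List Bool)),
      x.length < I.sup List.length + 1 := fun x hx => by
    have hx' : (decide (x ∈ I) && f x) = true := hx
    rw [Bool.and_eq_true, decide_eq_true_eq] at hx'
    exact Nat.lt_succ_of_le (Finset.le_sup (f := List.length) hx'.1)
  exact hL (bp_mono (soloBlind_PRel_subset_P_of_forall_length_lt _ hfin) hLA₀)

/-- **If `BQP ⊄ P` then `BQP^A ⊆ P^A` fails for comeager-many oracles `A`**: the set of oracles
with `BQP^A ⊆ P^A` is meagre. One oracle-free witness `L ∈ BQP ∖ P` serves every oracle, since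
oracle-free circuit families are oracle circuit families (`BQP ⊆ BQP^A`). -/
theorem soloBlind_isMeagre_setOf_BQPRel_subset_PRel (h : ¬ (BQP ⊆ Classes.P)) :
    IsMeagre {f : List Bool → Bool |
      BQPRel ({w | f w = true} : Set (List Bool)) ⊆ PRel (Oracle.ofLanguage {w | f w = true})} := by
  obtain ⟨L, hL, hLP⟩ := Set.not_subset.1 h
  exact (soloBlind_isMeagre_setOf_mem_PRel hLP).mono fun f hf => hf (BQP_subset_BQPRel _ hL)

/-- **Category rung, witness form.** The summit yields one oracle-free `L ∈ BQP`, lying in every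
`BQP^A`, such that `{A | L ∈ P^A}` is meagre. -/
theorem soloBlind_category_witness (h : _root_.QuantumAdvantage) :
    ∃ L : Language Bool, L ∈ BQP ∧ (∀ A : Language Bool, L ∈ BQPRel A) ∧
      IsMeagre {f : List Bool → Bool | L ∈ PRel (Oracle.ofLanguage {w | f w = true})} := by
  obtain ⟨L, hL, hL'⟩ := (id h : ∃ L : Language Bool, L ∈ BQP ∧ L ∉ BPP)
  exact ⟨L, hL, fun A => BQP_subset_BQPRel A hL, soloBlind_isMeagre_setOf_mem_PRel fun hP =>
    hL' (P_subset_BPP_of_almostP almostP_subset_BPP_holds hP)⟩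

/-- **Category (generic-oracle) rung of `QuantumAdvantage`.** If `BQP ≠ BPP` then for
comeager-many oracles `A` (a residual set in the Cantor space of oracles), `BQP^A ⊄ P^A`.
Contrast Fortnow–Rogers 1999, Thm. 3.6: `P = PSPACE` would force `P^G = BQP^G` for every
generic `G`. -/
theorem soloBlind_category_rung (h : _root_.QuantumAdvantage) :
    {f : List Bool → Bool | ¬ (BQPRel ({w | f w = true} : Set (List Bool)) ⊆
      PRel (Oracle.ofLanguage {w | f w = true}))} ∈ residual (List Bool → Bool) := by
  obtain ⟨L, hL, hL'⟩ := (id h : ∃ L : Language Bool, L ∈ BQP ∧ L ∉ BPP)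
  have hm := soloBlind_isMeagre_setOf_BQPRel_subset_PRel fun hsub =>
    hL' (P_subset_BPP_of_almostP almostP_subset_BPP_holds (hsub hL))
  exact hm

/-- The oracles `A` with `BQP^A ⊄ P^A` are dense in the Cantor space of oracles (Baire category
theorem for the compact Hausdorff space `{0,1}^{{0,1}*}`), granted the summit. -/
theorem soloBlind_category_rung_dense (h : _root_.QuantumAdvantage) :
    Dense {f : List Bool → Bool | ¬ (BQPRel ({w | f w = true} : Set (List Bool)) ⊆
      PRel (Oracle.ofLanguage {w | f w = true}))} :=
  dense_of_mem_residual (soloBlind_category_rung h)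

/-- **Category rung with `BPP^A` (the generic-oracle analogue of the summit), witness form.**
The summit yields one oracle-free `L ∈ BQP`, lying in every `BQP^A`, such that `{A | L ∈ BPP^A}`
is meagre. -/
theorem soloBlind_category_witness_BPPRel (h : _root_.QuantumAdvantage) :
    ∃ L : Language Bool, L ∈ BQP ∧ (∀ A : Language Bool, L ∈ BQPRel A) ∧
      IsMeagre {f : List Bool → Bool | L ∈ BPPRel (Oracle.ofLanguage {w | f w = true})} := by
  obtain ⟨L, hL, hL'⟩ := (id h : ∃ L : Language Bool, L ∈ BQP ∧ L ∉ BPP)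
  exact ⟨L, hL, fun A => BQP_subset_BQPRel A hL, soloBlind_isMeagre_setOf_mem_BPPRel hL'⟩

/-- **Category (generic-oracle) rung of `QuantumAdvantage`, `BPP^A` form.** If `BQP ≠ BPP` then
for comeager-many oracles `A`, `BQP^A ⊄ BPP^A` (the set of oracles with `BQP^A ⊆ BPP^A` is
meagre). By Fortnow–Rogers 1999, Thm. 3.6, this comeager statement in turn implies
`P ≠ PSPACE`; it is recorded as a consequence of the summit, not as a route to it. -/
theorem soloBlind_category_rung_BPPRel (h : _root_.QuantumAdvantage) :
    {f : List Bool → Bool | ¬ (BQPRel ({w | f w = true} : Set (List Bool)) ⊆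
      BPPRel (Oracle.ofLanguage {w | f w = true}))} ∈ residual (List Bool → Bool) := by
  obtain ⟨L, hL, hLrel, hm⟩ := soloBlind_category_witness_BPPRel h
  exact hm.mono fun f hf => hf (hLrel _)

/-- Density of the oracles with `BQP^A ⊄ BPP^A`, granted the summit (Baire). -/
theorem soloBlind_category_rung_BPPRel_dense (h : _root_.QuantumAdvantage) :
    Dense {f : List Bool → Bool | ¬ (BQPRel ({w | f w = true} : Set (List Bool)) ⊆
      BPPRel (Oracle.ofLanguage {w | f w = true}))} :=
  dense_of_mem_residual (soloBlind_category_rung_BPPRel h)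

end Summit.QuantumAdvantage.QuantumAdvantage.Theorems
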